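import Literature.AnabelianGeometry.EtaleTheta.ThetaRigidity
import HarnessLib

/-!
# [EtTh] Cor. 2.19 (i) ⇒ a mono-theta automorphism acts on the exterior cyclotome `μ_N` by the coefficient
# automorphism of its induced automorphism of `Π^tp_X` (proof-only)

S. Mochizuki, *The Étale Theta Function …* [EtTh], Publ. RIMS **45** (2009), §2, Cor. 2.19 (i) p.64
("cyclotomic rigidity": the isomorphism of cyclotomes `(l·Δ_Θ) ⊗ ℤ/Nℤ ⥲ μ_N` determined by the algebraic and
theta splittings is compatible with isomorphisms of mono-theta environments) and Cor. 2.18 (i) p.60 (bib key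
`MochizukiEtTh2009`; PDF pages of the PRIMS text). PROOF-ONLY companion (no `def`, no new named fact) of
abc-iut-L2-t2's `ThetaRigidity.lean` (`RigidData.Cor219_i_splittings`, `algImage`, `thetaImage`, `thetaMod`,
`sAlg_mul_sTheta_inv`); written by abc-iut-w5-d145 as the [EtTh] input of the `rho_comm` field of
`Literature.IUT.HodgeArakelov.MonoThetaBaseDatum` ([IUTchII] Cor. 1.10 sub-DAG row C110-S10a) and as the
PINNING LEMMA behind finding F-w5d145-1 (bridge B8 part 5b: structure isomorphisms do not twist the Def. 1.1
(ii) isomorphism, bare identifications do — `ModelReconstructionTwistWitness.lean`).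

* `RigidData.iso_sAlg_eq` / `iso_sTheta_eq`: an automorphism `α` of the model mono-theta environment lying
  over an automorphism `γ` of `Π^tp_X` (`proj ∘ α = γ ∘ proj`) and preserving the algebraic and theta
  images of `l·Δ_Θ` (the two clauses of `Cor219_i_splittings`) maps `s^alg(g) ↦ s^alg(γ g)` and
  `s^Θ(g) ↦ s^Θ(γ g)` for `g ∈ l·Δ_Θ`;
* `RigidData.iso_inMu_thetaMod`: hence `α(inMu(thetaMod g)) = inMu(thetaMod(γ g))` — `α` restricted to the
  exterior cyclotome `μ_N ⊆ Π^tp_Y[μ_N]` IS the coefficient automorphism induced by `γ` through `thetaMod`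
  (the difference of the two splittings, `sAlg_mul_sTheta_inv`);
* `RigidData.iso_inMu_eq_coeffAut`: in terms of any `γ̄_μ ∈ Aut(μ_N)` with `thetaMod (γ g) = γ̄_μ (thetaMod g)`
  (it exists under Cor. 2.18 (i): `RigidData.exists_mulEquiv_thetaMod_comp_of_cor218_i`,
  `Discharge/Sec2ModelConstantMultiple.lean`): `α(inMu a) = inMu(γ̄_μ a)` for ALL `a ∈ μ_N`;
* `RigidData.iso_inMu_eq_coeffAut_of_cor219` packages the two image clauses from the named statement
  `Cor219_i_splittings` (proved in `Discharge/Sec2CyclotomicRigidityProofs.lean` modulo Cor. 2.18 facts).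

HONEST FRAMING: a consequence of a refereed source's typed statements; no side is taken on [IUTchIII]
Cor. 3.12; typed ≠ discharged elsewhere.
-/

namespace Literature.AnabelianGeometry.EtaleTheta

universe u

namespace RigidData

variable {N : ℕ+} {l : ℕ} (R : RigidData.{u} N l)

/-- Membership in `algImage H`: the images `s^alg(g)` of the `g ∈ Π^tp_Ÿ` lying in `H`.
[cite: MochizukiEtTh2009, Prop 2.14(i) p.49] -/
theorem mem_algImage_iff (H : Subgroup R.PiX) (x : R.env) :
    x ∈ R.algImage H ↔ ∃ g : R.PiYdd, (g : R.PiX) ∈ H ∧ R.toThetaEnvData.sAlg g = x := by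
  constructor
  · rintro ⟨g, hg, rfl⟩
    exact ⟨g, hg, rfl⟩
  · rintro ⟨g, hg, rfl⟩
    exact ⟨g, hg, rfl⟩

/-- Membership in `thetaImage hη H`: the images `s^Θ(g)` of the `g ∈ Π^tp_Ÿ` lying in `H`.
[cite: MochizukiEtTh2009, Cor 2.19(i) p.64] -/
theorem mem_thetaImage_iff {η : R.PiYdd → R.mu} (hη : η ∈ R.thetaCocycles) (H : Subgroup R.PiX)
    (x : R.env) :
    x ∈ R.thetaImage hη H ↔ ∃ g : R.PiYdd, (g : R.PiX) ∈ H ∧ R.toThetaEnvData.sTheta hη g = x := by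
  constructor
  · rintro ⟨g, hg, rfl⟩
    exact ⟨g, hg, rfl⟩
  · rintro ⟨g, hg, rfl⟩
    exact ⟨g, hg, rfl⟩

/-- The projection of `s^alg(g)` is `g`. [cite: MochizukiEtTh2009, Def 2.13(i) p.47] -/
theorem coe_proj_sAlg (g : R.PiYdd) :
    ((CycEnvelope.proj R.augY R.chi (R.toThetaEnvData.sAlg g) : R.PiY) : R.PiX) = g := rfl

/-- The projection of `s^Θ(g)` is `g`. [cite: MochizukiEtTh2009, Def 2.13(i) p.47] -/
theorem coe_proj_sTheta {η : R.PiYdd → R.mu} (hη : η ∈ R.thetaCocycles) (g : R.PiYdd) :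
    ((CycEnvelope.proj R.augY R.chi (R.toThetaEnvData.sTheta hη g) : R.PiY) : R.PiX) = g := rfl

variable {R}

/-- **An automorphism preserving `algImage(l·Δ_Θ)` and lying over `γ` maps `s^alg(g) ↦ s^alg(γ g)`** for
`g ∈ l·Δ_Θ` (first clause of `Cor219_i_splittings`). [cite: MochizukiEtTh2009, Cor 2.19(i) p.64] -/
theorem iso_sAlg_eq (α : R.env ≃ₜ* R.env) (γ : R.PiX ≃* R.PiX)
    (hαγ : ∀ x : R.env, ((CycEnvelope.proj R.augY R.chi (α x) : R.PiY) : R.PiX) =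
      γ ((CycEnvelope.proj R.augY R.chi x : R.PiY) : R.PiX))
    (halg : (R.algImage R.lDeltaTheta).map α.toMulEquiv.toMonoidHom = R.algImage R.lDeltaTheta)
    (g : R.PiYdd) (hg : (g : R.PiX) ∈ R.lDeltaTheta) :
    ∃ (hγ : γ (g : R.PiX) ∈ R.PiYdd), γ (g : R.PiX) ∈ R.lDeltaTheta ∧
      α (R.toThetaEnvData.sAlg g) = R.toThetaEnvData.sAlg ⟨γ (g : R.PiX), hγ⟩ := by
  have hmem : α (R.toThetaEnvData.sAlg g) ∈ R.algImage R.lDeltaTheta := by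
    rw [← halg]
    exact ⟨R.toThetaEnvData.sAlg g, (R.mem_algImage_iff _ _).2 ⟨g, hg, rfl⟩, rfl⟩
  obtain ⟨g₁, hg₁, hg₁eq⟩ := (R.mem_algImage_iff _ _).1 hmem
  have hcoe : ((g₁ : R.PiYdd) : R.PiX) = γ (g : R.PiX) := by
    rw [← R.coe_proj_sAlg g₁, hg₁eq, hαγ, R.coe_proj_sAlg]
  refine ⟨hcoe ▸ g₁.2, hcoe ▸ hg₁, ?_⟩
  rw [← hg₁eq]
  congr 1
  exact Subtype.ext hcoe

/-- **… and maps `s^Θ(g) ↦ s^Θ(γ g)`** (second clause of `Cor219_i_splittings`).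
[cite: MochizukiEtTh2009, Cor 2.19(i) p.64] -/
theorem iso_sTheta_eq {η : R.PiYdd → R.mu} (hη : η ∈ R.thetaCocycles) (α : R.env ≃ₜ* R.env)
    (γ : R.PiX ≃* R.PiX)
    (hαγ : ∀ x : R.env, ((CycEnvelope.proj R.augY R.chi (α x) : R.PiY) : R.PiX) =
      γ ((CycEnvelope.proj R.augY R.chi x : R.PiY) : R.PiX))
    (hth : (R.thetaImage hη R.lDeltaTheta).map α.toMulEquiv.toMonoidHom = R.thetaImage hη R.lDeltaTheta)
    (g : R.PiYdd) (hg : (g : R.PiX) ∈ R.lDeltaTheta) :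
    ∃ (hγ : γ (g : R.PiX) ∈ R.PiYdd),
      α (R.toThetaEnvData.sTheta hη g) = R.toThetaEnvData.sTheta hη ⟨γ (g : R.PiX), hγ⟩ := by
  have hmem : α (R.toThetaEnvData.sTheta hη g) ∈ R.thetaImage hη R.lDeltaTheta := by
    rw [← hth]
    exact ⟨R.toThetaEnvData.sTheta hη g, (R.mem_thetaImage_iff hη _ _).2 ⟨g, hg, rfl⟩, rfl⟩
  obtain ⟨g₂, -, hg₂eq⟩ := (R.mem_thetaImage_iff hη _ _).1 hmem
  have hcoe : ((g₂ : R.PiYdd) : R.PiX) = γ (g : R.PiX) := by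
    rw [← R.coe_proj_sTheta hη g₂, hg₂eq, hαγ, R.coe_proj_sTheta]
  refine ⟨hcoe ▸ g₂.2, ?_⟩
  rw [← hg₂eq]
  congr 1
  exact Subtype.ext hcoe

/-- **Cor. 2.19 (i) ⇒ the action on the exterior cyclotome is the coefficient automorphism through
`thetaMod`**: for an automorphism `α` of `Π^tp_Y[μ_N]` lying over `γ ∈ Aut(Π^tp_X)` and preserving the
algebraic and theta images of `l·Δ_Θ`, `α(inMu(thetaMod g)) = inMu(thetaMod (γ g))` for all `g ∈ l·Δ_Θ`
(via `s^alg(g)·s^Θ(g)⁻¹ = inMu(thetaMod g)`, `sAlg_mul_sTheta_inv`). PROVED.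
[cite: MochizukiEtTh2009, Cor 2.19(i) p.64] -/
theorem iso_inMu_thetaMod {η : R.PiYdd → R.mu} (hη : η ∈ R.thetaCocycles) (α : R.env ≃ₜ* R.env)
    (γ : R.PiX ≃* R.PiX)
    (hαγ : ∀ x : R.env, ((CycEnvelope.proj R.augY R.chi (α x) : R.PiY) : R.PiX) =
      γ ((CycEnvelope.proj R.augY R.chi x : R.PiY) : R.PiX))
    (halg : (R.algImage R.lDeltaTheta).map α.toMulEquiv.toMonoidHom = R.algImage R.lDeltaTheta)
    (hth : (R.thetaImage hη R.lDeltaTheta).map α.toMulEquiv.toMonoidHom = R.thetaImage hη R.lDeltaTheta)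
    (g : R.PiYdd) (hg : (g : R.PiX) ∈ R.lDeltaTheta) :
    ∃ (hγ' : γ (g : R.PiX) ∈ R.lDeltaTheta),
      α (CycEnvelope.inMu R.augY R.chi (R.thetaMod ⟨g, hg⟩)) =
        CycEnvelope.inMu R.augY R.chi (R.thetaMod ⟨γ (g : R.PiX), hγ'⟩) := by
  obtain ⟨hγ, hγ', hsAlg⟩ := iso_sAlg_eq α γ hαγ halg g hg
  obtain ⟨hγ₂, hsTheta⟩ := iso_sTheta_eq hη α γ hαγ hth g hg
  refine ⟨hγ', ?_⟩
  rw [← R.sAlg_mul_sTheta_inv hη g hg, map_mul, map_inv, hsAlg, hsTheta]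
  exact R.sAlg_mul_sTheta_inv hη ⟨γ (g : R.PiX), hγ⟩ hγ'

/-- **The coefficient automorphism on `μ_N` agrees on both cyclotomes** (the `rho_comm` of [IUTchII]
Cor. 1.10's base datum at the model): with `γ̄_μ ∈ Aut(μ_N)` any automorphism satisfying
`thetaMod (γ g) = γ̄_μ (thetaMod g)` (it exists under Cor. 2.18 (i), `exists_mulEquiv_thetaMod_comp`), an
automorphism `α` of `Π^tp_Y[μ_N]` over `γ` preserving the two images acts on ALL of `μ_N` by `γ̄_μ`:
`α(inMu a) = inMu(γ̄_μ a)` (`thetaMod` is onto). PROVED. [cite: MochizukiEtTh2009, Cor 2.19(i) p.64] -/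
theorem iso_inMu_eq_coeffAut {η : R.PiYdd → R.mu} (hη : η ∈ R.thetaCocycles) (α : R.env ≃ₜ* R.env)
    (γ : R.PiX ≃* R.PiX)
    (hαγ : ∀ x : R.env, ((CycEnvelope.proj R.augY R.chi (α x) : R.PiY) : R.PiX) =
      γ ((CycEnvelope.proj R.augY R.chi x : R.PiY) : R.PiX))
    (halg : (R.algImage R.lDeltaTheta).map α.toMulEquiv.toMonoidHom = R.algImage R.lDeltaTheta)
    (hth : (R.thetaImage hη R.lDeltaTheta).map α.toMulEquiv.toMonoidHom = R.thetaImage hη R.lDeltaTheta)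
    (γμ : R.mu ≃* R.mu)
    (hγμ : ∀ (g : R.lDeltaTheta) (hg' : γ g ∈ R.lDeltaTheta), R.thetaMod ⟨γ g, hg'⟩ = γμ (R.thetaMod g))
    (a : R.mu) :
    α (CycEnvelope.inMu R.augY R.chi a) = CycEnvelope.inMu R.augY R.chi (γμ a) := by
  obtain ⟨g', rfl⟩ := R.thetaMod_surjective a
  -- `g' ∈ l·Δ_Θ ⊆ Π^tp_Ÿ`
  have hg'Y : (g' : R.PiX) ∈ R.PiYdd := (R.lDeltaTheta_le g'.2).1
  obtain ⟨hγ', h⟩ := iso_inMu_thetaMod hη α γ hαγ halg hth ⟨(g' : R.PiX), hg'Y⟩ g'.2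
  have hg'eq : (⟨((⟨(g' : R.PiX), hg'Y⟩ : R.PiYdd) : R.PiX), g'.2⟩ : R.lDeltaTheta) = g' := Subtype.ext rfl
  rw [hg'eq] at h
  rw [h, hγμ g' hγ']

/-- **The same, from the named statement Cor. 2.19 (i)** (`Cor219_i_splittings`, proved in
`Discharge/Sec2CyclotomicRigidityProofs.lean` modulo Cor. 2.18 facts): every automorphism of the model
mono-theta environment `M_η` lying over `γ` acts on `μ_N` by the coefficient automorphism `γ̄_μ` of `γ`.
[cite: MochizukiEtTh2009, Cor 2.19(i) p.64] -/
theorem iso_inMu_eq_coeffAut_of_cor219 (h219 : R.Cor219_i_splittings) {η : R.PiYdd → R.mu}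
    (hη : η ∈ R.thetaCocycles) (α : (R.modelMono hη).Iso (R.modelMono hη)) (γ : R.PiX ≃* R.PiX)
    (hαγ : ∀ x : R.env, ((CycEnvelope.proj R.augY R.chi (α.e x) : R.PiY) : R.PiX) =
      γ ((CycEnvelope.proj R.augY R.chi x : R.PiY) : R.PiX))
    (γμ : R.mu ≃* R.mu)
    (hγμ : ∀ (g : R.lDeltaTheta) (hg' : γ g ∈ R.lDeltaTheta), R.thetaMod ⟨γ g, hg'⟩ = γμ (R.thetaMod g))
    (a : R.mu) :
    α.e (CycEnvelope.inMu R.augY R.chi a) = CycEnvelope.inMu R.augY R.chi (γμ a) :=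
  iso_inMu_eq_coeffAut hη α.e γ hαγ (h219 η hη α).1 (h219 η hη α).2 γμ hγμ a

end RigidData

end Literature.AnabelianGeometry.EtaleTheta
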